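import Summits.ResolutionOfSingularities.ResolutionOfSingularities.Theorems.RadicialJungCleanModelsSufficeGameEndCharge
import Summits.ResolutionOfSingularities.ResolutionOfSingularities.Theorems.RadicialJungCleanModelsSufficeGameGerms

/-!
# Route `RadicialJung`, crux `CleanModelsSuffice`, line `Sketch`: the exceptionalisation game —
# charge constancy of the exceptional divisors in ANY game state

Helper for the registered stubs `stub_gameCentre1` / `stub_gameCentre2` of the skeleton of
`Summit.ResolutionOfSingularities.ResolutionOfSingularities.Theses.RadicialJung.CleanModelsSuffice`
(stmt-ResolutionOfSingularities-15883). `…GameEndCharge` proves CHARGE CONSTANCY (an exceptional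
divisor `D ∈ E` is charged at `v ∈ D` iff it is charged at the nearby points of `D`) for an END state,
through the bundle `S.EndHyp` of standing hypotheses, which contains the end condition. The phase-1 /
phase-2 centre stubs need the same statement MID-GAME. This file re-derives it from the explicit
hypotheses only (`p` prime, `V → Spec k` locally of finite type with `char k = p`, `[L : K(V)] = p` for a
`K(V)`-algebra structure on `L` compatible with `π^♯` and with the same image as `K(V₀) → L`):

* `y_pow_stalkSpecializes_of_compat`, `radicand_of_primeOfSpecializes_eq_of_compat` — the
  presentation at `x` read in the discrete valuation ring of a generisation along a divisor
  (unit · `ϖ^{a_x(ℓ)}`, residue not a `p`-th power when uncharged: `residue_not_pth_power`);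
* `chargedAt_iff_of_specializes_of_compat` — charge constancy under the generic point of the branch
  (`charge_iff`);
* `exists_nhds_chargedAt_iff_of_compat` — every `v` has a neighbourhood on which the exceptional
  divisors through a point pass through `v` with the same charge as at `v` (the interface consumed by
  the centre stubs).

The proofs are those of `…GameEndCharge` with `S.EndHyp` replaced by the explicit hypotheses.
-/

noncomputable section

set_option linter.dupNamespace false -- mandated namespace of this single-conjunct summit

open CategoryTheory AlgebraicGeometry TopologicalSpace IsLocalRing
open Literature.AlgebraicGeometry.Resolution Literature.AlgebraicGeometry.Motives Literature.RingTheory.RegularLocalRing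

namespace Summit.ResolutionOfSingularities.ResolutionOfSingularities.Theorems.RadicialJung.CleanModelsSuffice

attribute [local instance] stalkAlgebra isScalarTower_stalkAlgebra

namespace GameState

variable {p : ℕ} {V₀ : Scheme.{0}} [IsIntegral V₀] {L : Type} [Field L] [Algebra V₀.functionField L]
  {V : Scheme.{0}} [IsIntegral V] {π : V ⟶ V₀} [IsDominant π] [Algebra V.functionField L]
  (S : GameState p V₀ L V π)

/-! ## Standing hypotheses in explicit form -/

section Explicit

variable (hrange : Set.range (algebraMap V.functionField L) = Set.range (algebraMap V₀.functionField L))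
  (hcompat : ∀ g : V₀.functionField,
    algebraMap V.functionField L (RatFn.functionFieldMap π g) = algebraMap V₀.functionField L g)

include hcompat in
/-- **`y_x^p = w_x ∏ u_i^{a_i}` through `𝒪_{V,ζ} → L`** for a generisation `ζ ⤳ x`. [folklore] -/
theorem y_pow_stalkSpecializes_of_compat {ζ x : V} (h : ζ ⤳ x) :
    S.y x ^ p = algebraMap (V.presheaf.stalk ζ) L
      ((V.presheaf.stalkSpecializes h).hom (S.w x * ∏ i, S.u x i ^ S.a x i)) := by
  rw [← S.y_pow x, ← hcompat, S.map_g x, algebraMap_stalk_eq h, ← IsScalarTower.algebraMap_apply]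

omit [IsIntegral V] [Algebra V.functionField L] in
/-- Stalks of a scheme over a field of characteristic `p` (prime) have characteristic `p`. [folklore] -/
theorem charP_stalk_of_over (hp : p.Prime) (k : Type) [Field k] [CharP k p] (f : V ⟶ Spec (.of k))
    (x : V) : CharP (V.presheaf.stalk x) p :=
  CharP.of_ringHom_of_ne_zero
    ((V.presheaf.germ ⊤ x trivial).hom.comp (f.appTop.hom.comp (Scheme.ΓSpecIso (.of k)).inv.hom)) p
    hp.ne_zero

include hcompat in
/-- **The presentation at `x` in the discrete valuation ring of a generisation along a divisor**
(explicit hypotheses). Let `ζ ⤳ x`, `D` an exceptional divisor through `x` with label `ℓ`, the prime of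
`ζ` in `𝒪_{V,x}` equal to `(u_ℓ)` and `𝔪_ζ = (ϖ)`. Then `y_x^p = e ϖ^{a_x(ℓ)}` in `L` for a unit `e`
of `𝒪_{V,ζ}`, and if `a_x(ℓ) = 0` the residue of `e` is not a `p`-th power. [folklore] -/
theorem radicand_of_primeOfSpecializes_eq_of_compat (hp : p.Prime) (k : Type) [Field k] [CharP k p]
    (f : V ⟶ Spec (.of k)) {ζ x : V} (h : ζ ⤳ x)
    (D : {D : V.IdealSheafData // D ∈ S.E ∧ x ∈ D.support})
    (hP : primeOfSpecializes h = Ideal.span {S.u x (S.lab x D)}) (ϖ : V.presheaf.stalk ζ)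
    (hϖ : maximalIdeal (V.presheaf.stalk ζ) = Ideal.span {ϖ}) :
    ∃ e : V.presheaf.stalk ζ, IsUnit e ∧
      S.y x ^ p = algebraMap (V.presheaf.stalk ζ) L (e * ϖ ^ S.a x (S.lab x D)) ∧
      (S.a x (S.lab x D) = 0 → ∀ c d : V.presheaf.stalk ζ, d ∉ maximalIdeal (V.presheaf.stalk ζ) →
        d ^ p * e - c ^ p ∉ maximalIdeal (V.presheaf.stalk ζ)) := by
  classical
  haveI := S.isRegular x
  haveI := charP_stalk_of_over (V := V) hp k f x
  set ℓ := S.lab x D with hℓ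
  set σ := (V.presheaf.stalkSpecializes h).hom with hσ
  letI := σ.toAlgebra
  set P : Ideal (V.presheaf.stalk x) := Ideal.span {S.u x ℓ} with hPdef
  haveI hPp : P.IsPrime := by
    rw [hPdef, Ideal.span_singleton_prime ((RoundOff.isRsopPart_u S x).ne_zero ℓ)]
    exact (RoundOff.isRsopPart_u S x).prime ℓ
  haveI hloc : IsLocalization.AtPrime (V.presheaf.stalk ζ) P :=
    isLocalizationAtPrime_congr hP (Literature.AlgebraicGeometry.Resolution.isLocalizationAtPrime_stalkSpecializes h)
  -- the other coordinates become units, `u_ℓ` becomes a uniformizer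
  have hunit : ∀ i, i ∉ ({ℓ} : Finset (Fin (S.d x))) → IsUnit (σ (S.u x i)) := by
    intro i hi
    rw [hσ, isUnit_stalkSpecializes_iff h, hP, Ideal.mem_span_singleton]
    exact (RoundOff.isRsopPart_u S x).not_dvd fun h' => hi (Finset.mem_singleton.mpr h'.symm)
  have hmax : maximalIdeal (V.presheaf.stalk ζ) = Ideal.span {σ (S.u x ℓ)} := by
    rw [← IsLocalization.AtPrime.map_eq_maximalIdeal P (V.presheaf.stalk ζ), hPdef, Ideal.map_span,
      Set.image_singleton]
    rfl
  have hassoc : Associated ϖ (σ (S.u x ℓ)) := by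
    rw [← Ideal.span_singleton_eq_span_singleton, ← hϖ, hmax]
  obtain ⟨u₀, hu₀⟩ := hassoc
  obtain ⟨E, hE, hrad⟩ := S.radicand_stalkSpecializes h {ℓ} hunit
  rw [Finset.prod_singleton] at hrad
  refine ⟨E * (u₀ : V.presheaf.stalk ζ) ^ S.a x ℓ, hE.mul (u₀.isUnit.pow _), ?_, ?_⟩
  · rw [S.y_pow_stalkSpecializes_of_compat hcompat h, ← hσ, hrad, ← hu₀]
    congr 1
    ring
  · intro ha c d hd hmem
    rw [ha, pow_zero, mul_one] at hmem
    have hE' : E = σ (S.w x * ∏ i, S.u x i ^ S.a x i) := by rw [hrad, ha, pow_zero, mul_one]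
    rw [hE'] at hmem
    -- clear denominators
    obtain ⟨⟨c₀, s₁⟩, hc⟩ := IsLocalization.mk'_surjective P.primeCompl c
    obtain ⟨⟨d₀, s₂⟩, hdd⟩ := IsLocalization.mk'_surjective P.primeCompl d
    simp only at hc hdd
    have hd₀ : d₀ ∉ P := by
      rw [← hdd] at hd
      exact fun h' => hd ((IsLocalization.AtPrime.mk'_mem_maximal_iff (V.presheaf.stalk ζ) P d₀ s₂).mpr h')
    have hd₁ : (s₁ : V.presheaf.stalk x) * d₀ ∉ P := fun h' => (hPp.mem_or_mem h').elim s₁.2 hd₀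
    set τ := algebraMap (V.presheaf.stalk x) (V.presheaf.stalk ζ) with hτ
    have hd₁R : τ ((s₁ : V.presheaf.stalk x) * d₀) =
        τ (s₁ : V.presheaf.stalk x) * τ (s₂ : V.presheaf.stalk x) * d := by
      rw [map_mul, ← IsLocalization.mk'_spec' (V.presheaf.stalk ζ) d₀ s₂, hdd, mul_assoc]
    have hc₁R : τ ((s₂ : V.presheaf.stalk x) * c₀) =
        τ (s₁ : V.presheaf.stalk x) * τ (s₂ : V.presheaf.stalk x) * c := by
      rw [map_mul, ← IsLocalization.mk'_spec' (V.presheaf.stalk ζ) c₀ s₁, hc]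
      ring
    have hmemA : ((s₁ : V.presheaf.stalk x) * d₀) ^ p * (S.w x * ∏ i, S.u x i ^ S.a x i) -
        ((s₂ : V.presheaf.stalk x) * c₀) ^ p ∈ P := by
      rw [← IsLocalization.AtPrime.to_map_mem_maximal_iff (V.presheaf.stalk ζ) P]
      have h1 : τ (((s₁ : V.presheaf.stalk x) * d₀) ^ p *
          (S.w x * ∏ i, S.u x i ^ S.a x i) - ((s₂ : V.presheaf.stalk x) * c₀) ^ p) =
          (τ (s₁ : V.presheaf.stalk x) * τ (s₂ : V.presheaf.stalk x)) ^ p *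
            (d ^ p * σ (S.w x * ∏ i, S.u x i ^ S.a x i) - c ^ p) := by
        rw [map_sub, map_mul, map_pow, map_pow, hd₁R, hc₁R]
        change _ * σ _ - _ = _
        ring
      change τ _ ∈ _
      rw [h1]
      exact Ideal.mul_mem_left _ _ hmem
    exact residue_not_pth_power p hp (S.u x) (S.span_u x) (S.spanFinrank_eq x) (S.a x) (S.a_spec x)
      (S.w x) (S.isUnit_w x) (Set.range (S.lab x)) ℓ ⟨D, rfl⟩ ha (S.reg x) _ _ hd₁ hmemA

include hrange hcompat in
/-- **CHARGE CONSTANCY along an exceptional divisor** (explicit hypotheses, any game state). Let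
`D ∈ E` pass through `v` and `w`, and let the generic point of the branch of `D` at `v` specialise to
`w`. Then `D` is charged at `v` iff it is charged at `w`: both presentations `y_v`, `y_w ∈ L ∖ K(V)` are
clean generators over the discrete valuation ring at that generic point, charged ones with exponent
prime to `p`, uncharged ones with non-`p`-th-power residue, and `charge_iff` applies. [folklore] -/
theorem chargedAt_iff_of_specializes_of_compat (hp : p.Prime) (k : Type) [Field k] [CharP k p]
    (f : V ⟶ Spec (.of k)) (hdegV : Module.finrank V.functionField L = p) {v w : V}
    (D : V.IdealSheafData) (hDv : D ∈ S.E ∧ v ∈ D.support) (hDw : D ∈ S.E ∧ w ∈ D.support)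
    (hw : S.genPt v (S.lab v ⟨D, hDv⟩) ⤳ w) : S.chargedAt D v ↔ S.chargedAt D w := by
  haveI : CharP V.functionField p := charP_stalk_of_over (V := V) hp k f _
  set ℓ := S.lab v ⟨D, hDv⟩ with hℓ
  set ζ := S.genPt v ℓ with hζ
  haveI := S.isRegular ζ
  obtain ⟨hDVR, hmax⟩ := S.dvr_genPt v ℓ
  haveI := hDVR
  set ϖ := (V.presheaf.stalkSpecializes (S.genPt_specializes v ℓ)).hom (S.u v ℓ) with hϖ
  have hirr : Irreducible ϖ := (IsDiscreteValuationRing.irreducible_iff_uniformizer ϖ).mpr hmax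
  obtain ⟨e₁, he₁, hyp₁, hNP₁⟩ := S.radicand_of_primeOfSpecializes_eq_of_compat hcompat hp k f
    (S.genPt_specializes v ℓ) ⟨D, hDv⟩ (S.primeOfSpecializes_genPt v ℓ) ϖ hmax
  obtain ⟨e₂, he₂, hyp₂, hNP₂⟩ := S.radicand_of_primeOfSpecializes_eq_of_compat hcompat hp k f hw
    ⟨D, hDw⟩ (S.primeOfSpecializes_genPt_eq D hDv hDw hw) ϖ hmax
  have key := charge_iff (R := V.presheaf.stalk ζ) (K := V.functionField) hp hdegV hirr
    he₁.unit he₂.unit (S.a v ℓ) (S.a w (S.lab w ⟨D, hDw⟩)) (S.a_spec v _) (S.a_spec w _) (S.y v) (S.y w)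
    (S.y_not_mem_range_of_range_eq hrange v) (S.y_not_mem_range_of_range_eq hrange w)
    (by rw [he₁.unit_spec]; exact hyp₁) (by rw [he₂.unit_spec]; exact hyp₂)
    (by rw [he₁.unit_spec]; exact hNP₁) (by rw [he₂.unit_spec]; exact hNP₂)
  rw [S.chargedAt_iff, S.chargedAt_iff]
  constructor
  · rintro ⟨_, h⟩
    exact ⟨hDw, fun h2 => h (key.mpr h2)⟩
  · rintro ⟨_, h⟩
    exact ⟨hDv, fun h1 => h (key.mp h1)⟩

include hrange hcompat in
/-- **Every point has a neighbourhood on which the exceptional divisors through a point pass through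
`v` with the same charge as at `v`** — for ANY game state (explicit hypotheses; the interface consumed
by the centre stubs `stub_gameCentre1` / `stub_gameCentre2`). [folklore] -/
theorem exists_nhds_chargedAt_iff_of_compat (hp : p.Prime) (k : Type) [Field k] [CharP k p]
    (f : V ⟶ Spec (.of k)) [LocallyOfFiniteType f] (hdegV : Module.finrank V.functionField L = p)
    (v : V) :
    ∃ U : V.Opens, v ∈ U ∧ ∀ w ∈ U, ∀ D ∈ S.E,
      (w ∈ D.support → v ∈ D.support) ∧ (w ∈ D.support → (S.chargedAt D w ↔ S.chargedAt D v)) := by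
  haveI hN : IsLocallyNoetherian V := LocallyOfFiniteType.isLocallyNoetherian f
  obtain ⟨U₁, hv₁, hU₁⟩ := S.exists_nhds_forall_mem_support v
  obtain ⟨U₂, hv₂, hU₂⟩ := S.exists_nhds_forall_genPt_specializes hN v
  refine ⟨U₁ ⊓ U₂, ⟨hv₁, hv₂⟩, fun w hw D hD => ⟨fun hwD => hU₁ w hw.1 D hD hwD, fun hwD => ?_⟩⟩
  have hvD : v ∈ D.support := hU₁ w hw.1 D hD hwD
  exact (S.chargedAt_iff_of_specializes_of_compat hrange hcompat hp k f hdegV D ⟨hD, hvD⟩ ⟨hD, hwD⟩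
    (hU₂ w hw.2 D ⟨hD, hvD⟩ hwD)).symm

end Explicit

end GameState

end Summit.ResolutionOfSingularities.ResolutionOfSingularities.Theorems.RadicialJung.CleanModelsSuffice

end
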